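import Summits.BirchSwinnertonDyer.Rank1Residual.Additive.RationalLineTwistRamifiedOfKernelPolynomial
import HarnessLib

/-!
# `hram` from a SHIFTED kernel-polynomial certificate: the generalised-Eisenstein condition on
# `h(X + s)` for an integer shift `s` (cell `bsd-addord`, seat `bsd-addord-twist`; File C of the Φ₀
# kernel-records programme at `p ≥ 5`, shifted form)

HONEST FRAMING (cell `bsd-addord`, `run/shared/lean/pub/bsd-addord/README.md` §4): the programme's
target of record is the full Birch–Swinnerton-Dyer formula for every `E/ℚ` of analytic rank `≤ 1`;
this is a TOOL file (theorems only, no definition, no named fact, no `sorry`). It books nothing.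

## What and why

`RationalLineTwistRamifiedOfKernelPolynomial.lean` proves the `hram` column of the line datum from
the valuation certificate `p^{m−k} ∣ c_k` (`0 < k < m`), `c₀ = p^{m−1}·a`, `p ∤ a` on the kernel
polynomial `h` of `Φ₀` in the coordinate `x` of the member `W`. That certificate says that ALL roots
`α` of `h` have `|p| < |α|_𝔓 < 1`; but on a general globally minimal model the abscissas of the
canonical-subgroup line are `≡ x₀ (mod 𝔓)` for the abscissa `x₀` of the singular point of `W mod p`,
which need not be `0` (row `3025g2`: `h = x² − 91x − 16231` at `p = 5`, `x₀ ≡ 3`). The cure is the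
translation `x ↦ x − s` by an integer `s ≡ x₀`: this file proves
* `val_sub_eq_one_or_le_of_twisted_inertia` — the CORE of the argument, isolated: on a twist model
  `D • V^{(p*)} = W` (`V` good ordinary at `p ≥ 5`), if every inertia group above `p` acts on the
  rational line `Φ₀` through the character of `K = ℚ(√p*)`, then for every non-zero `P = (α, y) ∈ Φ₀`
  and every integer `s`: `|α − s| = 1` or `|α − s| ≤ |p|` (the transported line is unramified, so
  `x_V` is `𝔓`-integral, and `α − s = u⁻²·p*·x₁ − (r u⁻² + s)` with `|x₁| ≤ 1`, `r u⁻² + s ∈ ℤ_(p)`);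
* **`hram_of_twist_model_of_shiftedKernelPolyCert`** / **`ClassX3Gord.hram_of_shiftedKernelPolyCert`**:
  if `g = h(X + s)` satisfies the generalised-Eisenstein certificate then `|p| < |α − s| < 1` for the
  root `α − s` of `g` (`lt_val_root`, `val_root_lt_one`) — contradiction, so `hram` holds.
The unshifted theorems are the case `s = 0`.

References: R. Greenberg, V. Vatsal, Invent. Math. 142 (2000) §2 p. 28 [GreenbergVatsal2000];
J.-P. Serre, Invent. Math. 15 (1972) §1.11 [Serre1972]; J. H. Silverman, *AEC* 2nd ed., VII.2.1,
X.5 Cor. 5.4 [SilvermanAEC2009]; HOME/proof/phi0-p5/README.md (dictionary `hram`).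
-/

set_option autoImplicit false

noncomputable section

open scoped Classical NumberField

open WeierstrassCurve Polynomial Literature.NumberTheory.EllipticCurves
  Literature.NumberTheory.EllipticCurves.Rank1Residual Literature.NumberTheory.GaloisRepresentations
  Field IsDedekindDomain NumberField
  Summit.BirchSwinnertonDyer.Rank1Residual.AdditivePotMult

namespace Summit.BirchSwinnertonDyer.Rank1Residual.Additive.KernelPolyLine

variable {W : WeierstrassCurve ℚ} [W.IsGloballyMinimal] {p : ℕ} [hp : Fact p.Prime]

/-- **Core of the `hram` argument.** On a twist model `D • V^{(p*)} = W` with `V` globally minimal and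
good ordinary at `p ≥ 5`: if every inertia group above `p` acts on the rational `p`-line `Φ₀ ≤ E[p]`
through the character of the quadratic field `K ∋ θ`, `θ² = p*`, then the abscissa `α` of every
non-zero point of `Φ₀` satisfies, for every integer `s`, `|α − s|_𝔓 = 1` or `|α − s|_𝔓 ≤ |p|`
(`𝔓 = placeOver p`). [cite: Serre1972, §1.11] [cite: SilvermanAEC2009, VII.2.1, X.5 Cor. 5.4] -/
theorem val_sub_eq_one_or_le_of_twisted_inertia (hp5 : 5 ≤ p) {V : WeierstrassCurve ℚ} [V.IsElliptic]
    [V.IsGloballyMinimal] (hV : GoodOrd V p) {D : VariableChange ℚ}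
    (hC : D • V.quadraticTwist ((-1) ^ (p / 2) * p) = W)
    {Φ₀ : AddSubgroup (geomTorsion W (p : ℤ))} (hΦ : IsRationalLine W p Φ₀)
    {K : Type} [Field K] [NumberField K] (hK2 : Module.finrank ℚ K = 2) {θ : K}
    (hθ2 : θ ^ 2 = algebraMap ℚ K ((-1) ^ (p / 2) * p))
    (H : ∀ v : HeightOneSpectrum (𝓞 ℚ), ((p : ℕ) : 𝓞 ℚ) ∈ v.asIdeal →
      ∀ 𝔓 ∈ v.primesAbove, ∀ σ ∈ 𝔓.inertia (Field.absoluteGaloisGroup ℚ), ∀ P ∈ Φ₀,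
        σ • P = (if σ ∈ galRange (K := ℚ) K then P else -P))
    {P : geomTorsion W (p : ℤ)} (hPΦ : P ∈ Φ₀) (hP0 : P ≠ 0) {α y : AlgebraicClosure ℚ}
    {hxy : (W.baseChange (AlgebraicClosure ℚ)).toAffine.Nonsingular α y}
    (hPe : (P : W.geomPoints) = Affine.Point.some α y hxy) (s : ℤ) :
    (placeOver p).valuation (α - (s : AlgebraicClosure ℚ)) = 1 ∨
      (placeOver p).valuation (α - (s : AlgebraicClosure ℚ)) ≤
        (placeOver p).valuation ((p : ℕ) : AlgebraicClosure ℚ) := by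
  have hpr : p.Prime := hp.out
  have hp2 : p ≠ 2 := by omega
  have hθnr : θ ∉ Set.range (algebraMap ℚ K) := not_mem_range_algebraMap_of_sq_eq_pStar hθ2
  obtain ⟨e, hpos, hneg, hcoord⟩ := exists_torsionEquiv_of_twist_model K hθnr hθ2 hC p hK2
  -- the transported line `Φ_V = e(Φ₀) ≤ V[p]`
  set ΦV : AddSubgroup (geomTorsion V (p : ℤ)) :=
    Φ₀.map (e : geomTorsion W (p : ℤ) →+ geomTorsion V (p : ℤ)) with hΦV
  have hΦVrat : IsRationalLine V p ΦV := by
    refine ⟨?_, ?_⟩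
    · rw [hΦV]
      exact (Nat.card_congr (e.addSubgroupMap Φ₀).toEquiv.symm).trans hΦ.1
    · intro σ S hS
      obtain ⟨T, hT, rfl⟩ := AddSubgroup.mem_map.mp hS
      by_cases hσ : σ ∈ galRange (K := ℚ) K
      · change σ • e T ∈ ΦV
        rw [← hpos σ hσ T]
        exact AddSubgroup.mem_map.mpr ⟨σ • T, hΦ.2 σ T hT, rfl⟩
      · change σ • e T ∈ ΦV
        have h1 : σ • e T = e (-(σ • T)) := by
          rw [map_neg, hneg σ hσ T, neg_neg]
        rw [h1]
        exact AddSubgroup.mem_map.mpr ⟨-(σ • T), Φ₀.neg_mem (hΦ.2 σ T hT), rfl⟩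
  -- ... which is UNRAMIFIED at `p` under the hypothesis `H`
  have hunr : LineUnramifiedAt V p ΦV := by
    intro v hv 𝔓 h𝔓 σ hσ S hS
    obtain ⟨T, hT, rfl⟩ := AddSubgroup.mem_map.mp hS
    have hT' := H v hv 𝔓 h𝔓 σ hσ T hT
    change σ • e T = e T
    by_cases hg : σ ∈ galRange (K := ℚ) K
    · rw [if_pos hg] at hT'
      rw [← hpos σ hg T, hT']
    · rw [if_neg hg] at hT'
      have h1 : e (σ • T) = -(σ • e T) := hneg σ hg T
      rw [hT', map_neg, neg_inj] at h1
      exact h1.symm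
  -- the abscissa `x_V` of the image of `P` is `𝔓`-integral
  obtain ⟨xd, xV, yV, hV', heP, hx, hx1⟩ := hcoord P α y hxy hPe
  have hePmem : e P ∈ ΦV := AddSubgroup.mem_map.mpr ⟨P, hPΦ, rfl⟩
  have heP0 : e P ≠ 0 := (AddEquiv.map_ne_zero_iff e).mpr hP0
  have hint : (placeOver p).valuation xV ≤ 1 :=
    (KernelDisc.lineUnramifiedAt_iff_valuation_le_one hΦVrat hp2 hV.1 hV.2 hePmem heP0 heP).mp hunr
  -- valuation bookkeeping
  set v := (placeOver p).valuation with hvdef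
  set π := v ((p : ℕ) : AlgebraicClosure ℚ) with hπdef
  have hπ1 : π < 1 := valuation_placeOver_natCast_lt_one p
  obtain ⟨hu2, hr2⟩ := val_sqChange p hp5 V
  obtain ⟨hu, hru⟩ := val_twistModelChange p hp5 hV.1 hC
  have htc : rootInClosure K θ ^ 2 = algebraMap ℚ (AlgebraicClosure ℚ) ((-1) ^ (p / 2) * p) :=
    rootInClosure_sq K hθ2
  have ht0 : rootInClosure K θ ≠ 0 := by
    intro h0
    rw [h0, zero_pow two_ne_zero] at htc
    exact (pStar_ne_zero p) ((algebraMap ℚ (AlgebraicClosure ℚ)).injective (by rw [map_zero]; exact htc)).symm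
  -- `|x_d| ≤ π`
  have hxd : xd = rootInClosure K θ ^ 2 *
      (algebraMap ℚ (AlgebraicClosure ℚ) (((sqChange V).u⁻¹ : ℚˣ) : ℚ) ^ 2 *
        (xV - algebraMap ℚ (AlgebraicClosure ℚ) (sqChange V).r)) := by
    rw [hx1, ← mul_assoc, ← mul_pow, mul_inv_cancel₀ ht0, one_pow, one_mul]
  have hvxd : v xd ≤ π := by
    rw [hxd, Valuation.map_mul, Valuation.map_pow, ← Valuation.map_pow, htc, val_pStar_eq p,
      Valuation.map_mul, Valuation.map_pow, hu2, one_pow, one_mul]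
    refine mul_le_of_le_one_right' ?_
    exact Valuation.map_sub_le _ hint hr2
  -- `α − s = A − B`, `|A| ≤ π`, `B = r u⁻² + s` rational with `|B| ≤ 1`
  have hαeq : α - (s : AlgebraicClosure ℚ) = algebraMap ℚ (AlgebraicClosure ℚ) ((D.u⁻¹ : ℚˣ) : ℚ) ^ 2 * xd -
      algebraMap ℚ (AlgebraicClosure ℚ) (D.r * ((D.u⁻¹ : ℚˣ) : ℚ) ^ 2 + s) := by
    rw [hx, map_add, map_mul, map_pow, map_intCast]; ring
  have hvA : v (algebraMap ℚ (AlgebraicClosure ℚ) ((D.u⁻¹ : ℚˣ) : ℚ) ^ 2 * xd) ≤ π := by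
    rw [Valuation.map_mul, Valuation.map_pow]
    calc v (algebraMap ℚ (AlgebraicClosure ℚ) ((D.u⁻¹ : ℚˣ) : ℚ)) ^ 2 * v xd ≤ 1 * π :=
          mul_le_mul' (pow_le_one₀ zero_le hu) hvxd
      _ = π := one_mul π
  have hvB : v (algebraMap ℚ (AlgebraicClosure ℚ) (D.r * ((D.u⁻¹ : ℚˣ) : ℚ) ^ 2 + s)) ≤ 1 := by
    rw [map_add, map_intCast]
    exact Valuation.map_add_le _ hru (val_intCast_le_one p s)
  -- dichotomy on the rational `B`
  rcases val_ratCast_eq_one_or_le p _ hvB with hB1 | hBle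
  · left
    rw [hαeq, sub_eq_add_neg, Valuation.map_add_eq_of_lt_right, Valuation.map_neg, hB1]
    rw [Valuation.map_neg, hB1]
    exact lt_of_le_of_lt hvA hπ1
  · right
    rw [hαeq]
    exact Valuation.map_sub_le _ hvA hBle

omit [W.IsGloballyMinimal] in
/-- A root `α` of `h` gives the root `α − s` of `h(X + s)`. [folklore] -/
theorem eval_comp_X_add_C_sub {h : ℚ[X]} {s : ℤ} {α : AlgebraicClosure ℚ}
    (hα : (h.map (algebraMap ℚ (AlgebraicClosure ℚ))).eval α = 0) :
    ((h.comp (X + C (s : ℚ))).map (algebraMap ℚ (AlgebraicClosure ℚ))).eval (α - (s : AlgebraicClosure ℚ)) = 0 := by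
  rw [Polynomial.map_comp, eval_comp, Polynomial.map_add, Polynomial.map_X, Polynomial.map_C, eval_add,
    eval_X, eval_C, map_intCast, sub_add_cancel]
  exact hα

/-- **`hram` from a twist model and a SHIFTED valuation certificate.** As
`hram_of_twist_model_of_kernelPolyCert`, with the generalised-Eisenstein condition placed on
`g = h(X + s)` for an integer `s`: `p^{m−k} ∣ g_k` (`0 < k < m`), `g₀ = p^{m−1}·a`, `p ∤ a`.
[cite: GreenbergVatsal2000, §2 p. 28] [cite: Serre1972, §1.11] -/
theorem hram_of_twist_model_of_shiftedKernelPolyCert (hp5 : 5 ≤ p) {V : WeierstrassCurve ℚ} [V.IsElliptic]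
    [V.IsGloballyMinimal] (hV : GoodOrd V p) {D : VariableChange ℚ}
    (hC : D • V.quadraticTwist ((-1) ^ (p / 2) * p) = W)
    {h : ℚ[X]} {m : ℕ} (hm : 2 * m + 1 = p) (hmon : h.Monic) (hdegm : h.natDegree = m) (s : ℤ)
    (hcoef : ∀ k, 0 < k → k < m → ∃ c : ℤ, (h.comp (X + C (s : ℚ))).coeff k = (c : ℚ) ∧ (p : ℤ) ^ (m - k) ∣ c)
    (hzero : ∃ a : ℤ, (h.comp (X + C (s : ℚ))).coeff 0 = (p : ℚ) ^ (m - 1) * a ∧ ¬ (p : ℤ) ∣ a)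
    {Φ₀ : AddSubgroup (geomTorsion W (p : ℤ))} (hΦ : IsRationalLine W p Φ₀)
    (habs : ∀ Q ∈ Φ₀, Q ≠ 0 → ∃ (x y : AlgebraicClosure ℚ)
      (hxy : (W.baseChange (AlgebraicClosure ℚ)).toAffine.Nonsingular x y),
      (Q : W.geomPoints) = Affine.Point.some x y hxy ∧
        (h.map (algebraMap ℚ (AlgebraicClosure ℚ))).eval x = 0) :
    ∀ (K : Type) [Field K] [NumberField K] [(galRange (K := ℚ) K).Normal],
      Module.finrank ℚ K = 2 → (∃ θ : K, θ ^ 2 = algebraMap ℚ K ((-1) ^ (p / 2) * p)) →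
      ¬ ∀ v : HeightOneSpectrum (𝓞 ℚ), ((p : ℕ) : 𝓞 ℚ) ∈ v.asIdeal →
        ∀ 𝔓 ∈ v.primesAbove, ∀ σ ∈ 𝔓.inertia (Field.absoluteGaloisGroup ℚ), ∀ P ∈ Φ₀,
          σ • P = (if σ ∈ galRange (K := ℚ) K then P else -P) := by
  intro K _ _ _ hK2 hθ H
  obtain ⟨θ, hθ2⟩ := hθ
  have hm2 : 2 ≤ m := by omega
  -- the shifted polynomial `g = h(X + s)`: monic of degree `m`
  set g : ℚ[X] := h.comp (X + C (s : ℚ)) with hg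
  have hgmon : g.Monic := hmon.comp_X_add_C _
  have hgdeg : g.natDegree = m := by
    rw [hg, natDegree_comp, natDegree_X_add_C, mul_one, hdegm]
  -- a point of `Φ₀`: `α − s` is a root of `g`
  obtain ⟨P, hPΦ, hP0⟩ := RationalLineTwist.exists_mem_ne_zero_of_isRationalLine hΦ
  obtain ⟨α, y, hxy, hPe, hα⟩ := habs P hPΦ hP0
  have hβ : (g.map (algebraMap ℚ (AlgebraicClosure ℚ))).eval (α - (s : AlgebraicClosure ℚ)) = 0 :=
    eval_comp_X_add_C_sub hα
  -- `π < |α − s| < 1`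
  have hcoef' : ∀ k, k < m → ∃ c : ℤ, g.coeff k = (c : ℚ) ∧ (p : ℤ) ∣ c := by
    intro k hk
    rcases Nat.eq_zero_or_pos k with rfl | hk0
    · obtain ⟨a, ha, -⟩ := hzero
      refine ⟨(p : ℤ) ^ (m - 1) * a, by rw [ha]; push_cast; ring, ?_⟩
      exact dvd_mul_of_dvd_left (dvd_pow_self _ (by omega)) a
    · obtain ⟨c, hc, hdvd⟩ := hcoef k hk0 hk
      exact ⟨c, hc, (dvd_pow_self _ (by omega)).trans hdvd⟩
  have hlt1 : (placeOver p).valuation (α - (s : AlgebraicClosure ℚ)) < 1 :=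
    val_root_lt_one p hgmon hgdeg hcoef' hβ
  have hgt : (placeOver p).valuation ((p : ℕ) : AlgebraicClosure ℚ) <
      (placeOver p).valuation (α - (s : AlgebraicClosure ℚ)) :=
    lt_val_root p hgmon hgdeg hm2 hcoef hzero hβ
  -- versus the dichotomy
  rcases val_sub_eq_one_or_le_of_twisted_inertia hp5 hV hC hΦ hK2 hθ2 H hPΦ hP0 hPe s with h1 | hle
  · exact absurd h1 hlt1.ne
  · exact absurd hgt (not_lt.mpr hle)

/-- **X3♯(G-ord) ∩ `I₀*` at `p ≥ 5`: `hram` from the SHIFTED kernel-polynomial certificate** (twist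
model from `ClassX3Gord.exists_goodOrd_pStar_twist_model`). [cite: GreenbergVatsal2000, §2 p. 28] -/
theorem ClassX3Gord.hram_of_shiftedKernelPolyCert [W.IsElliptic] (hX : ClassX3Gord W p) (hp5 : 5 ≤ p)
    (he : semistabilityIndex W p = 2)
    {h : ℚ[X]} {m : ℕ} (hm : 2 * m + 1 = p) (hmon : h.Monic) (hdegm : h.natDegree = m) (s : ℤ)
    (hcoef : ∀ k, 0 < k → k < m → ∃ c : ℤ, (h.comp (X + C (s : ℚ))).coeff k = (c : ℚ) ∧ (p : ℤ) ^ (m - k) ∣ c)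
    (hzero : ∃ a : ℤ, (h.comp (X + C (s : ℚ))).coeff 0 = (p : ℚ) ^ (m - 1) * a ∧ ¬ (p : ℤ) ∣ a)
    {Φ₀ : AddSubgroup (geomTorsion W (p : ℤ))} (hΦ : IsRationalLine W p Φ₀)
    (habs : ∀ Q ∈ Φ₀, Q ≠ 0 → ∃ (x y : AlgebraicClosure ℚ)
      (hxy : (W.baseChange (AlgebraicClosure ℚ)).toAffine.Nonsingular x y),
      (Q : W.geomPoints) = Affine.Point.some x y hxy ∧
        (h.map (algebraMap ℚ (AlgebraicClosure ℚ))).eval x = 0) :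
    ∀ (K : Type) [Field K] [NumberField K] [(galRange (K := ℚ) K).Normal],
      Module.finrank ℚ K = 2 → (∃ θ : K, θ ^ 2 = algebraMap ℚ K ((-1) ^ (p / 2) * p)) →
      ¬ ∀ v : HeightOneSpectrum (𝓞 ℚ), ((p : ℕ) : 𝓞 ℚ) ∈ v.asIdeal →
        ∀ 𝔓 ∈ v.primesAbove, ∀ σ ∈ 𝔓.inertia (Field.absoluteGaloisGroup ℚ), ∀ P ∈ Φ₀,
          σ • P = (if σ ∈ galRange (K := ℚ) K then P else -P) := by
  have hp2 : p ≠ 2 := by have := hp.out.two_le; omega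
  obtain ⟨V, iV, iVm, D, hV, hC⟩ := ClassX3Gord.exists_goodOrd_pStar_twist_model W p hp2 hX he
  exact hram_of_twist_model_of_shiftedKernelPolyCert hp5 hV hC hm hmon hdegm s hcoef hzero hΦ habs

end Summit.BirchSwinnertonDyer.Rank1Residual.Additive.KernelPolyLine

end
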